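import Literature.AlgebraicGeometry.Resolution.WeightedCentreStepDirectrix
import Literature.AlgebraicGeometry.Resolution.HironakaDirectrixPolar
import HarnessLib

/-!
# The gradient test for position 2 of the weighted step (join of the directrix rule and the polar bound)

Topic: `Literature/AlgebraicGeometry/Resolution`.  `WeightedCentreStepDirectrix` proves the
DIRECTRIX RULE: a new germ `g` of the same order `ν` whose initial form has Hironaka's
`τ(in_ν g) > leadCount_ν(a)` beats the old value `a` at position `leadCount + 1` (a DROP), and a
STALL forces `τ(in_ν g) = 1`.  `HironakaDirectrixPolar` proves the computable lower bound
`dim ⟨∂ᵢ in_ν g⟩ ≤ τ(in_ν g)` in every characteristic.  Composing the two gives a test that needs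
no invariance space and no centre of `g`: **if `c` partial derivatives of the initial form of the new
germ are linearly independent and the old value has fewer than `c` leading entries `ν`, the step is a
DROP** (`stepDrops_of_linearIndependent_pderiv`); census shapes `stepDrops_cons_cons_of_linearIndependent_pderiv_pair`,
`stepDrops_singleton_of_linearIndependent_pderiv_pair`; contrapositive for the census's STALL column:
**at a STALL against `(ν, a₂ > ν, …)` every two partials of `in_ν g` are linearly dependent**
(`not_linearIndependent_pderiv_pair_of_stepStalls`) — in characteristic `0` or `> ν` this says the
gradient of the tangent cone spans a line.  Worked instance (`stepDrops_of_initialForm_eq_sq_add_sq`):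
any `g ∈ k[Y₀, Y₁, Y₂]` of order `2` with `in₂ g = Y₀² + Y₁²` beats `(2, a₂ > 2, …)` when `2 ≠ 0` in
`k` — the Whitney-umbrella point of the FE30 step census, a DROP at position 2 in every characteristic
`≠ 2` (in characteristic 2 it is the STALL `S4#66@p2`).
References: [ATW24] = Abramovich–Temkin–Włodarczyk 2024 (the invariant, Thm. 5.3.1 / §5.1, Thm. 6.2.1);
[CoP1] = Cossart–Piltant 2008 proof of Prop. 4.2 (τ); [CJS] = Cossart–Jannsen–Saito 2020 (Def. 2.8,
proof of Lemma 14.10).  Instrument typing for the resolution observatory (pub-rosobs, carver g38);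
NOT summit progress.
-/

noncomputable section

open MvPolynomial

namespace Literature.AlgebraicGeometry.Resolution

namespace WeightedBlowup

universe u

variable {k : Type u} [Field k] {m : ℕ}

/-- **Gradient test for a DROP.**  Old value `a` (sorted, entries `≥ ν`), new germ `g` of order `ν`;
if `c` partial derivatives of `in_ν g` are linearly independent and `leadCount_ν(a) < c` then
`StepDrops a (W g)`. [cite: AbramovichTemkinWlodarczyk2024, Thm. 5.3.1 (2)-(3) (p. 1578) and Thm. 6.2.1
(p. 1581)], [cite: CossartPiltant2008, proof of Prop. 4.2] -/
theorem stepDrops_of_linearIndependent_pderiv {g : MvPolynomial (Fin m) k} {ν : ℕ}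
    (hg : monomialOrd (fun _ => 1) g = ν) {a : List ℚ} (hs : a.Pairwise (· ≤ ·))
    (hge : ∀ x ∈ a, (ν : ℚ) ≤ x) {ι : Type*} [Fintype ι] (e : ι → Fin m)
    (hli : LinearIndependent k fun j : ι => pderiv (e j) (homogeneousComponent ν g))
    (hc : leadCount (ν : ℚ) a < Fintype.card ι) :
    StepDrops a (admissibleInvariants g) :=
  stepDrops_of_leadCount_lt_hironakaTau hg hs hge
    (lt_of_lt_of_le hc (card_le_hironakaTau_of_linearIndependent_pderiv k _ e hli))

/-- **Census shape.**  `a = (ν, a₂, …)` with `ν < a₂` and two linearly independent partials of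
`in_ν g` ⟹ DROP (at position 2). [cite: AbramovichTemkinWlodarczyk2024, §5.1 (p. 1575), Thm. 6.2.1
(p. 1581)], [cite: CossartPiltant2008, proof of Prop. 4.2] -/
theorem stepDrops_cons_cons_of_linearIndependent_pderiv_pair {g : MvPolynomial (Fin m) k} {ν : ℕ}
    (hg : monomialOrd (fun _ => 1) g = ν) {i j : Fin m}
    (hli : LinearIndependent k ![pderiv i (homogeneousComponent ν g),
      pderiv j (homogeneousComponent ν g)])
    {a₂ : ℚ} (ha₂ : (ν : ℚ) < a₂) (t : List ℚ) :
    StepDrops ((ν : ℚ) :: a₂ :: t) (admissibleInvariants g) := by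
  refine stepDrops_cons_cons_of_two_le_hironakaTau hg ?_ ha₂ t
  have h := card_le_hironakaTau_of_linearIndependent_pderiv k (homogeneousComponent ν g) ![i, j]
    (ι := Fin 2) ?_
  · simpa using h
  · convert hli using 1
    funext l
    fin_cases l <;> rfl

/-- **Census shape, one-entry old value.**  `a = (ν)` and two independent partials of `in_ν g` ⟹
DROP. [cite: AbramovichTemkinWlodarczyk2024, §5.1 (p. 1575)], [cite: CossartPiltant2008, proof of
Prop. 4.2] -/
theorem stepDrops_singleton_of_linearIndependent_pderiv_pair {g : MvPolynomial (Fin m) k} {ν : ℕ}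
    (hg : monomialOrd (fun _ => 1) g = ν) {i j : Fin m}
    (hli : LinearIndependent k ![pderiv i (homogeneousComponent ν g),
      pderiv j (homogeneousComponent ν g)]) :
    StepDrops [(ν : ℚ)] (admissibleInvariants g) := by
  refine stepDrops_singleton_of_two_le_hironakaTau hg ?_
  have h := card_le_hironakaTau_of_linearIndependent_pderiv k (homogeneousComponent ν g) ![i, j]
    (ι := Fin 2) ?_
  · simpa using h
  · convert hli using 1
    funext l
    fin_cases l <;> rfl

/-- **STALL ⟹ the gradient of the tangent cone has rank ≤ 1**: at a STALL against `(ν, a₂ > ν, …)`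
no two partial derivatives of `in_ν g` are linearly independent (every characteristic; in
characteristic `0` or `> ν`: the gradient spans a line). [cite: AbramovichTemkinWlodarczyk2024,
Thm. 6.2.1 (p. 1581)], [cite: CossartPiltant2008, proof of Prop. 4.2] -/
theorem not_linearIndependent_pderiv_pair_of_stepStalls {g : MvPolynomial (Fin m) k} {ν : ℕ}
    (hg : monomialOrd (fun _ => 1) g = ν) {a₂ : ℚ} (ha₂ : (ν : ℚ) < a₂) (t : List ℚ)
    (h : StepStalls ((ν : ℚ) :: a₂ :: t) (admissibleInvariants g)) (i j : Fin m) :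
    ¬ LinearIndependent k ![pderiv i (homogeneousComponent ν g),
      pderiv j (homogeneousComponent ν g)] := fun hli =>
  not_stepStalls_of_stepDrops (stepDrops_cons_cons_of_linearIndependent_pderiv_pair hg hli ha₂ t) h

/-- **The Whitney-umbrella row.**  Any `g ∈ k[Y₀, Y₁, Y₂]` of order `2` with initial form
`Y₀² + Y₁²` beats `(2, a₂, …)`, `2 < a₂`, when `2 ≠ 0` in `k`: a DROP at position 2 in every
characteristic `≠ 2`. [cite: AbramovichTemkinWlodarczyk2024, Thm. 6.2.1 (p. 1581)],
[cite: CossartPiltant2008, proof of Prop. 4.2] -/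
theorem stepDrops_of_initialForm_eq_sq_add_sq (h2 : (2 : k) ≠ 0) {g : MvPolynomial (Fin 3) k}
    (hg : monomialOrd (fun _ => 1) g = 2) (hin : homogeneousComponent 2 g = X 0 ^ 2 + X 1 ^ 2)
    {a₂ : ℚ} (ha₂ : (2 : ℚ) < a₂) (t : List ℚ) :
    StepDrops ((2 : ℚ) :: a₂ :: t) (admissibleInvariants g) := by
  have hτ : 2 ≤ hironakaTau k ({homogeneousComponent 2 g} : Set (MvPolynomial (Fin 3) k)) := by
    rw [hin]; exact two_le_hironakaTau_sq_add_sq k h2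
  have := stepDrops_cons_cons_of_two_le_hironakaTau (ν := 2) hg hτ ha₂ t
  simpa using this

end WeightedBlowup

end Literature.AlgebraicGeometry.Resolution

end
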